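import Mathlib
import Summits.ValiantsHypothesis.ValiantsHypothesis.Theorems.GrenetZeonTwoDimCoefficientsDualUnipotentTriangular

/-!
# The triangularisable rung, conjugation-invariant form

Crux `GrenetZeon.TwoDimCoefficients` (stmt-ValiantsHypothesis-8062), stub `stub_dualUnipotent`.
`sq_le_of_trace_pow_mul_strictUpper` (`…DualUnipotentTriangular.lean`) assumes the pencil `N` strictly
upper triangular; here the hypothesis is a constant change of basis `P` making it so
(`sq_le_of_trace_pow_mul_triangularisable`): conjugate `N, M` by `P` (entries stay affine,
`isAffine_conj`) and use `tr((P⁻¹NP)^d·(P⁻¹MP)) = tr(N^d·M)`.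

HONEST FRAMING: bookkeeping for a sub-case rung of an ASIDE item; `VP ≠ VNP` is not moved.
-/

set_option linter.dupNamespace false

noncomputable section

namespace Summit.ValiantsHypothesis.ValiantsHypothesis.Cruxes.TwoDimCoefficients.DimTwoCases

open MvPolynomial Matrix
open Literature.Computability.AlgebraicComplexity

variable {n m : ℕ}

/-- Conjugating an affine matrix pencil by constant matrices keeps it affine. [folklore] -/
theorem isAffine_conj (G H : Matrix (Fin m) (Fin m) ℂ)
    (N : Matrix (Fin m) (Fin m) (MvPolynomial (Fin n × Fin n) ℂ)) (hN : ∀ i j, (N i j).totalDegree ≤ 1) :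
    ∀ i j, (((G.map C : Matrix (Fin m) (Fin m) (MvPolynomial (Fin n × Fin n) ℂ)) * N *
      (H.map C : Matrix (Fin m) (Fin m) (MvPolynomial (Fin n × Fin n) ℂ))) i j).totalDegree ≤ 1 := by
  intro i j
  rw [Matrix.mul_apply]
  refine (totalDegree_finsetSum _ _).trans (Finset.sup_le fun b _ => ?_)
  rw [Matrix.mul_apply, Matrix.map_apply, Finset.sum_mul]
  refine (totalDegree_finsetSum _ _).trans (Finset.sup_le fun a _ => ?_)
  rw [Matrix.map_apply]
  calc (C (G i a) * N a b * C (H b j)).totalDegree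
      ≤ (C (G i a) * N a b).totalDegree + (C (H b j)).totalDegree := totalDegree_mul _ _
    _ ≤ ((C (G i a)).totalDegree + (N a b).totalDegree) + (C (H b j)).totalDegree :=
        Nat.add_le_add_right (totalDegree_mul _ _) _
    _ ≤ 1 := by rw [totalDegree_C, totalDegree_C, zero_add, add_zero]; exact hN a b

/-- **Triangularisable rung.** If `per_n = tr(N^d·M)` with affine `m × m` pencils and the pencil `N`
is simultaneously strictly upper triangularisable by a constant invertible `P` (i.e. `P⁻¹·N·P` is
strictly upper triangular as a matrix of polynomials), then `n² ≤ 2kn + m·q` for all `q ≥ 1`,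
`m ≤ k·q` — hence `m ≳ n^{3/2}/(2√2)`. [folklore] -/
theorem sq_le_of_trace_pow_mul_triangularisable {d q k : ℕ}
    (N M : Matrix (Fin m) (Fin m) (MvPolynomial (Fin n × Fin n) ℂ))
    (hN : ∀ i j, (N i j).totalDegree ≤ 1) (hM : ∀ i j, (M i j).totalDegree ≤ 1)
    (P : Matrix (Fin m) (Fin m) ℂ) (hP : IsUnit P.det)
    (htri : ∀ i j : Fin m, j ≤ i →
      ((P⁻¹.map C : Matrix (Fin m) (Fin m) (MvPolynomial (Fin n × Fin n) ℂ)) * N *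
        (P.map C : Matrix (Fin m) (Fin m) (MvPolynomial (Fin n × Fin n) ℂ))) i j = 0)
    (hper : perPoly (Fin n) ℂ = (N ^ d * M).trace) (hq : 1 ≤ q) (hmk : m ≤ k * q) :
    n ^ 2 ≤ k * (2 * n) + m * q := by
  set PC : Matrix (Fin m) (Fin m) (MvPolynomial (Fin n × Fin n) ℂ) := P.map C with hPC
  set PiC : Matrix (Fin m) (Fin m) (MvPolynomial (Fin n × Fin n) ℂ) := P⁻¹.map C with hPiC
  have hPP : PC * PiC = 1 := by
    rw [hPC, hPiC, ← RingHom.mapMatrix_apply, ← RingHom.mapMatrix_apply, ← map_mul,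
      Matrix.mul_nonsing_inv P hP, map_one]
  have hPP' : PiC * PC = 1 := by
    rw [hPC, hPiC, ← RingHom.mapMatrix_apply, ← RingHom.mapMatrix_apply, ← map_mul,
      Matrix.nonsing_inv_mul P hP, map_one]
  -- conjugated pencils
  have hpow : ∀ e : ℕ, (PiC * N * PC) ^ e = PiC * N ^ e * PC := by
    intro e
    induction e with
    | zero => rw [pow_zero, pow_zero, Matrix.mul_one, hPP']
    | succ e ih =>
        rw [pow_succ, ih, pow_succ]
        simp only [Matrix.mul_assoc]
        rw [← Matrix.mul_assoc PC PiC, hPP, Matrix.one_mul]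
  have htrace : ((PiC * N * PC) ^ d * (PiC * M * PC)).trace = (N ^ d * M).trace := by
    rw [hpow, show PiC * N ^ d * PC * (PiC * M * PC) = PiC * (N ^ d * M * PC) by
      simp only [Matrix.mul_assoc]; rw [← Matrix.mul_assoc PC PiC, hPP, Matrix.one_mul],
      Matrix.trace_mul_comm, Matrix.mul_assoc, hPP, Matrix.mul_one]
  refine sq_le_of_trace_pow_mul_strictUpper (d := d) (PiC * N * PC) (PiC * M * PC)
    (isAffine_conj _ _ N hN) (isAffine_conj _ _ M hM) htri ?_ hq hmk
  rw [htrace, hper]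

end Summit.ValiantsHypothesis.ValiantsHypothesis.Cruxes.TwoDimCoefficients.DimTwoCases

end
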